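/-
Copyright (c) 2026 the pub-hodgecm-mathlib formalisation cell (harness21).  Prover seat hodgecm-mathlib-LH4-p08 (g9), req620 Track A «(D-RAM) FOUR-FRAME» squad, helper lane
on h413 = stmt-HodgeConjecture-24833 (count-neutral).  STAGE-1b, RamM lane of the (LAW) END — the DOWNSTREAM BLOCK of the level socket `levelsCensusC` (dealer WORD #113 (1)),
the RamM twin of ★ p860440 `levelsCensusB`'s closing block (LH4-p07 (g9)).  2026-09-04.
-/
import Summits.HodgeConjecture.HodgeConjecture.Theorems.F0P3cDyRamLevelsSocketPrelude           -- ★ p860127 (LH4-p07): `levels_bottom_arith`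
import Summits.HodgeConjecture.HodgeConjecture.Theorems.F0P3cDyRamLevelsCensusLawArithRamK       -- ★ p859957 (LH4-p07): `law_arith`, `sum_pow_add_eq_mul_sum`
import Summits.HodgeConjecture.HodgeConjecture.Theorems.F0P3cDyRamLevelsLawExponentsRamM         -- ★ p860594 (LH4-p07): `exponents_std_ramM`, `exponents_flip_ramM` (regime A)
import Summits.HodgeConjecture.HodgeConjecture.Theorems.F0P3cDyRamLevelsLawExponentsRamMRegB     -- ★ p860818 (LH4-p07): `exponents_std_ramM_regB`, `exponents_flip_ramM_regB` (regime B)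
import Summits.HodgeConjecture.HodgeConjecture.Theorems.F0P3cDyRamToricCensusSumRamMCutoff       -- ★ (LH4-p04 lineage): `filter_band_eq_Ioc_ramM`
import HarnessLib

/-!
# Crux `H413`, line LH4 «(D-RAM) FOUR-FRAME» — STAGE-1b, RamM lane: «`levelsCensusC_of_organs`» — THE SOCKET'S DOWNSTREAM BLOCK AS ONE ORGAN (both parity lanes)

Cell `hodgecm-mathlib` (D-0151), FLOOR 0, crux item H413 = `stmt-HodgeConjecture-24833`, route of record `HCCMUnconditional`; squad F0∕P3c∕LH4 (req618∕req620); helper lane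
`--supports stmt-HodgeConjecture-24833 --as helper` (count-neutral).  THEOREMS ONLY (no `def`, no instance, no notation, no named fact, no `sorry`; default heartbeats).
PURE ARITHMETIC (ℕ ∕ ℤ ∕ ℚ): no field, no place, no lattice.

The level socket `levelsCensusC` (LH4-p07 (g9), SIG 7d4a4a70) reads the RamM frame at the CM place exactly as ★ (C) `orderCountCensusC` does, cuts the two level order
counts `A = cnt_{a,b}(ι t_h)`, `A′ = cnt_{a,b}(ι t_a)` at `C = m + jl − b` (★ p860481 ∕ ★ p860730), welds them at the scaled multiplier `μ₁ = (ιϖ^a)⁻¹(λ − ιu₀)` ((R3′)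
LH4-p06 (g7) over (R2-frame) ★ p860873 over (R1) ★ p860848 and (R2) ED. 2 ★ p860773), and then closes by arithmetic.  THIS FILE is that closing arithmetic as ONE call per
parity lane — the RamM twin of the last twelve lines of ★ p860440 `levelsCensusB` (type RamK): from the WELD VALUE in its ★ letter shape at the scaled tokens
`(m − a, jl − a)` (hypothesis `hweld`), the H-SIDE CLOSED FORM `(q − 1)·F + 2 = 2·q^{n+1}` (hypothesis `hH`, ★ `hSide_closedForm_ramM_hLevel`'s shape with
`n + 1 = (jl − g)∕2 + 1`), the sign `ε ∈ {±1}`, the regime letter `hreg` of ★ (C) (A: `m + s0 ≤ jl`, same parity; B: `jl + 1 = m + s0`) and the piece's exponent rule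
(`hks`, `hT`), conclude the SIG's right-hand side `((q − 1)·q^{ks}·(A − A′) = ε·q^m·((q − 1)·F + 2 − 2·q^T)`: ★ `levels_bottom_arith` ← ★ `filter_band_eq_Ioc_ramM` +
★ `sum_pow_add_eq_mul_sum` ← regime dispatch → ★ p860594 `exponents_{std,flip}_ramM` ∕ ★ p860818 `…_regB` → ★ `law_arith`.
* **`levelsCensusC_of_organs_std`** (`a` even; `hweld` = (R2-frame) `toricCensusSum_ramM_weld_cut_of_frame`'s ∕ ★ p860773 `…_weld_cut_v2`'s value at `(m − a, jl − a)`) and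
  **`levelsCensusC_of_organs_flip`** (`a` odd; the `_flip` value).  Letters beyond the ★ organs' own: `hfar : m − a + 2g + s0 ≤ C + 2` and `hdjl : d + a ≤ jl` (the socket
  has both by `omega` from its depth letters, as ★ p860440 :344–:346).
HONEST LABEL.  Count-neutral helper; pure arithmetic, nothing about any place or lattice is asserted; the RamM level socket itself is LH4-p07 (g9)'s and OPEN; `HC_CM` is
proved only modulo the 7 printed citations (2 remaining named inputs: hLiu418 = `stmt-HodgeConjecture-24832`, h413 = `stmt-HodgeConjecture-24833`) until rung 0 closes.

## References
* [Rogawski1990] J. D. Rogawski, *Automorphic Representations of Unitary Groups in Three Variables*, Ann. of Math. Stud. 123 (1990): §4.9 Prop. 4.9.1 (b) p. 55, Lemma 4.9.3 p. 56.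
* [Kottwitz1986BaseChangeUnits] R. E. Kottwitz, *Base change for unit elements of Hecke algebras*, Compositio Math. 60 (1986): §1 pp. 240–241.
* [LabesseLanglands1979] J.-P. Labesse, R. P. Langlands, *L-indistinguishability for SL(2)*, Canad. J. Math. 31 (1979): §2 pp. 7–8.
-/

set_option autoImplicit false

open Finset
open Summit.HodgeConjecture.HodgeConjecture.Cruxes.H413.F0P3cDyRamLevelsSocketPrelude (levels_bottom_arith)
open Summit.HodgeConjecture.HodgeConjecture.Cruxes.H413.F0P3cDyRamLevelsCensusLawArithRamK (law_arith sum_pow_add_eq_mul_sum)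
open Summit.HodgeConjecture.HodgeConjecture.Cruxes.H413.F0P3cDyRamLevelsLawExponentsRamM (exponents_std_ramM exponents_flip_ramM)
open Summit.HodgeConjecture.HodgeConjecture.Cruxes.H413.F0P3cDyRamLevelsLawExponentsRamMRegB (exponents_std_ramM_regB exponents_flip_ramM_regB)
open Summit.HodgeConjecture.HodgeConjecture.Cruxes.H413.F0P3cDyRamToricCensusSumRamMCutoff (filter_band_eq_Ioc_ramM)

namespace Summit.HodgeConjecture.HodgeConjecture.Cruxes.H413.F0P3cDyRamLevelsCensusRamMOfOrgans

/-- **THE SOCKET'S DOWNSTREAM BLOCK, STANDARD LANE (`a` even).**  From the weld value at the scaled tokens `(m − a, jl − a)` in ★ p860773 ∕ (R2-frame)'s letter shape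
(`hweld`), the H-side closed form (`hH`), the sign, ★ (C)'s regime letter `hreg` and the piece's exponent rule: the level census law's right-hand side.
★ `levels_bottom_arith` ← ★ `filter_band_eq_Ioc_ramM` + ★ `sum_pow_add_eq_mul_sum` ← (`hreg`: A → ★ `exponents_std_ramM`, B → ★ `exponents_std_ramM_regB`) → ★ `law_arith`.
[cite: Rogawski1990, §4.9 Prop. 4.9.1 (b) p. 55, Lemma 4.9.3 p. 56] [cite: Kottwitz1986BaseChangeUnits, §1 pp. 240–241] [cite: LabesseLanglands1979, §2 pp. 7–8] -/
theorem levelsCensusC_of_organs_std {q a b d g s0 ks T m jl n C F A A' : ℕ} {ε : ℤ}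
    (hq1 : 1 ≤ q) (hx : (q : ℚ) ≠ 1) (hε : ε = 1 ∨ ε = -1)
    (hgs : g + s0 = d) (hg : 1 ≤ g) (hs0 : 1 ≤ s0) (hjlpar : jl % 2 = g % 2)
    (hreg : (m + s0 ≤ jl ∧ (m + s0) % 2 = jl % 2) ∨ jl + 1 = m + s0) (hmjl : m ≤ jl)
    (hab1 : d + 2 * a ≤ b + 1) (hbm : b ≤ m) (hC : C = m + jl - b) (hn : (jl - g) / 2 + 1 = n + 1) (ha2 : a % 2 = 0)
    (hks : 2 * ks + 2 * ((d + a % 2) / 2) = a + a % 2 + (b + b % 2)) (hT : a % 2 = 0 → T + a = ks + (d - d % 2))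
    (hdjl : d + a ≤ jl) (hfar : m - a + 2 * g + s0 ≤ C + 2)
    (hweld : (ε : ℚ) * (((A : ℕ) : ℚ) - ((A' : ℕ) : ℚ)) =
      (q : ℚ) ^ (m - a) * (2 * ∑ i ∈ range ((jl - a - g) / 2 + 1), (q : ℚ) ^ i - 2 * ∑ i ∈ range (g + s0 - (g + s0) % 2), (q : ℚ) ^ i) -
        2 * ∑ a' ∈ (range (jl - a + 2)).filter (fun a' => a' ≤ m - a ∧ C + (m - a) < jl - a + 2 * a' ∧
          2 * (m - a) + 2 * g + s0 < jl - a + 2 * a' + 2 ∧ 2 * a' + (g + s0) ≤ 2 * (m - a) + 1), (q : ℚ) ^ (a' + (jl - a + s0) / 2))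
    (hH : (q - 1) * F + 2 = 2 * q ^ (n + 1)) :
    ((q : ℤ) - 1) * (q : ℤ) ^ ks * ((A : ℤ) - (A' : ℤ)) = ε * (q : ℤ) ^ m * (((q : ℤ) - 1) * (F : ℤ) + 2 - 2 * (q : ℤ) ^ T) := by
  have hm1jl1 : m - a ≤ jl - a := by omega
  have hC1 : jl - a ≤ C := by omega
  refine levels_bottom_arith hε hweld ?_ hH hq1
  rw [filter_band_eq_Ioc_ramM hg hs0 hm1jl1 hC1 hfar, sum_pow_add_eq_mul_sum, ← mul_assoc (2 : ℚ)]
  rcases hreg with ⟨-, hApar⟩ | hB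
  · -- regime A (★ (C) :294): `m ≡ g + s0 = d`
    have hmpar : m % 2 = d % 2 := by omega
    obtain ⟨eLU, e1, e2, e3⟩ := exponents_std_ramM hgs hjlpar hmpar hmjl hab1 hbm hg hs0 hC hn ha2 hks hT hdjl
    exact law_arith _ hx eLU e1 e2 e3
  · -- regime B: `jl + 1 = m + s0`
    obtain ⟨eLU, e1, e2, e3⟩ := exponents_std_ramM_regB hgs hjlpar hB hmjl hab1 hbm hg hs0 hC hn ha2 hks hT hdjl
    exact law_arith _ hx eLU e1 e2 e3

/-- **THE SOCKET'S DOWNSTREAM BLOCK, FLIPPED LANE (`a` odd).**  As `levelsCensusC_of_organs_std` with ★ p860773 ∕ (R2-frame)'s FLIPPED value (`hweld`) and the odd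
exponent rule `hT`; regime A → ★ `exponents_flip_ramM`, B → ★ `exponents_flip_ramM_regB`.
[cite: Rogawski1990, §4.9 Prop. 4.9.1 (b) p. 55, Lemma 4.9.3 p. 56] [cite: Kottwitz1986BaseChangeUnits, §1 pp. 240–241] [cite: LabesseLanglands1979, §2 pp. 7–8] -/
theorem levelsCensusC_of_organs_flip {q a b d g s0 ks T m jl n C F A A' : ℕ} {ε : ℤ}
    (hq1 : 1 ≤ q) (hx : (q : ℚ) ≠ 1) (hε : ε = 1 ∨ ε = -1)
    (hgs : g + s0 = d) (hg : 1 ≤ g) (hs0 : 1 ≤ s0) (hjlpar : jl % 2 = g % 2)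
    (hreg : (m + s0 ≤ jl ∧ (m + s0) % 2 = jl % 2) ∨ jl + 1 = m + s0) (hmjl : m ≤ jl)
    (hab1 : d + 2 * a ≤ b + 1) (hbm : b ≤ m) (hC : C = m + jl - b) (hn : (jl - g) / 2 + 1 = n + 1) (ha2 : a % 2 = 1)
    (hks : 2 * ks + 2 * ((d + a % 2) / 2) = a + a % 2 + (b + b % 2)) (hT : a % 2 = 1 → T + a + 1 = ks + (d - d % 2) + 2 * (d % 2))
    (hdjl : d + a ≤ jl) (hfar : m - a + 2 * g + s0 ≤ C + 2)
    (hweld : (ε : ℚ) * (((A : ℕ) : ℚ) - ((A' : ℕ) : ℚ)) =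
      (q : ℚ) ^ (m - a) * (2 * ∑ i ∈ range ((jl - a + 1 - g) / 2 + (g + s0) % 2), (q : ℚ) ^ i - 2 * ∑ i ∈ range (g + s0 - 1 + (g + s0) % 2), (q : ℚ) ^ i) -
        2 * ∑ a' ∈ (range (jl - a + 2)).filter (fun a' => a' ≤ m - a ∧ C + (m - a) < jl - a + 2 * a' ∧
          2 * (m - a) + 2 * g + s0 < jl - a + 2 * a' + 2 ∧ 2 * a' + (g + s0) ≤ 2 * (m - a) + 1), (q : ℚ) ^ (a' + (jl - a + s0) / 2))
    (hH : (q - 1) * F + 2 = 2 * q ^ (n + 1)) :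
    ((q : ℤ) - 1) * (q : ℤ) ^ ks * ((A : ℤ) - (A' : ℤ)) = ε * (q : ℤ) ^ m * (((q : ℤ) - 1) * (F : ℤ) + 2 - 2 * (q : ℤ) ^ T) := by
  have hm1jl1 : m - a ≤ jl - a := by omega
  have hC1 : jl - a ≤ C := by omega
  refine levels_bottom_arith hε hweld ?_ hH hq1
  rw [filter_band_eq_Ioc_ramM hg hs0 hm1jl1 hC1 hfar, sum_pow_add_eq_mul_sum, ← mul_assoc (2 : ℚ)]
  rcases hreg with ⟨-, hApar⟩ | hB
  · -- regime A: `m ≡ g + s0 = d`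
    have hmpar : m % 2 = d % 2 := by omega
    obtain ⟨eLU, e1, e2, e3⟩ := exponents_flip_ramM hgs hjlpar hmpar hmjl hab1 hbm hg hs0 hC hn ha2 hks hT hdjl
    exact law_arith _ hx eLU e1 e2 e3
  · -- regime B: `jl + 1 = m + s0`
    obtain ⟨eLU, e1, e2, e3⟩ := exponents_flip_ramM_regB hgs hjlpar hB hmjl hab1 hbm hg hs0 hC hn ha2 hks hT hdjl
    exact law_arith _ hx eLU e1 e2 e3

end Summit.HodgeConjecture.HodgeConjecture.Cruxes.H413.F0P3cDyRamLevelsCensusRamMOfOrgans
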